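import Mathlib
import Summits.Schanuel.Schanuel.Theses.CoprimeExpPolynomials
import HarnessLib.Audit

/-!
# Birth skeleton (BC3) — crux `QbarRankGradedSchanuel` (stmt-Schanuel-3762), route `CoprimeExpPolynomials`

`Cruxes/QbarRankGradedSchanuel/Lines/birth.lean` · registrar planner-skel-stmt-Schanuel-3762-0 · 2026-08-17 ·
mode skeleton-register (route re-audit bin REPAIRABLE).  The crux is FIXED and is concluded BY NAME:

  `Summit.Schanuel.Schanuel.Theses.CoprimeExpPolynomials.QbarRankGradedSchanuel`

(the route's target, auto-crux since 2026-08-16: Schanuel's conjecture GRADED BY EXACT ℚ̄-RANK — for every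
`r`, every `ζ : Fin r → ℂ` admitting no non-trivial linear relation with algebraic coefficients and every
algebraic `n × r` matrix `b` with `ℚ`-linearly independent rows, `n ≤ trdeg_ℚ ℚ(ζ, e^{b₁·ζ}, …, e^{bₙ·ζ})`;
all `r` together ⟺ Schanuel by the route items `Assembly` (3774) / `GradedOfSchanuel` (3770)).

## The cut — base layer + climbing the ℚ̄-rank (induction on `r`)

Write `Layer r` for the `r`-th conjunct of the crux (token-identical copy of its body, §0; the crux is
`∀ r, Layer r` by `Iff.rfl`).  `Layer 0` is vacuous (the rows of `b` live in the zero module `Fin 0 → ℂ`, so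
`LinearIndependent ℚ b` forces `n = 0`; proved in §3), and the crux is assembled by INDUCTION ON THE RANK from

* `stub_rankOne` (XL, open; = the route's support item `RankOneSchanuel`, stmt-Schanuel-3766, VERBATIM —
  `Sig.stub_rankOne ↔ RankOneSchanuel` is `Iff.rfl`, §1) — the base layer `r = 1`, "Lindemann–Weierstrass at a
  transcendental scale": `ζ ≠ 0`, `β₁ … βₙ` algebraic and `ℚ`-linearly independent ⟹
  `n ≤ trdeg_ℚ ℚ(ζ, e^{β₁ζ}, …, e^{βₙζ})`.  This is where the WHOLE ranked programme of the route enters the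
  target: crux 2 `CoprimeExpPolynomialsNoCommonZero` ⟹ `RankOneSchanuel` is the support item
  `RankOneOfCoprime` (3768), and cruxes 3–5 hang below crux 2 / `RankOneSchanuel` (supports 3767, 3771–3773).
  The passage `RankOneSchanuel → Layer 1` (one coordinate `ζ 0`, slopes `b i 0`, `Fin.sum_univ_one`,
  `range ζ = {ζ 0}`) is PROVED here (§3, `layer_one_of_rankOne`; it is the converse bookkeeping of the
  support item `RankOneOfGraded`, 3769).
* `stub_rankClimb` (XL, open, HARDEST) — the inductive step "one more ℚ̄-independent direction":
  `∀ r ≥ 1, Layer r → Layer (r + 1)`.  This names, as ONE typed statement, exactly the gap recorded in the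
  crux's why-might-fail and in the route review (refuter-rreview aa031e05, 2026-08-15: "layers r ≥ 2
  (AlgIndepLogarithms barrier, (1, πi)) have no item, so cruxes + glue ⇏ target"): after this skeleton the
  cruxes DO reach the target, through `stub_rankOne`, and what they do not reach is isolated in
  `stub_rankClimb`.  Why it might fail / why it is hard: `Layer 2` already contains `(1, πi)` (algebraic
  independence of `e` and `π`) and every pair of `ℚ̄`-independent logarithms of algebraic numbers
  (`Literature.Barriers.Schanuel.AlgebraicIndependenceOfLogarithms`); no mechanism of this route (Ritt
  factorisation, Shapiro-type zero counting, p-adic Skolem–Mahler–Lech — all ONE complex variable) climbs from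
  a line `ℚ̄ζ` to a plane.  It is stated from `r ≥ 1`, not `r ≥ 0`: with the vacuous `Layer 0` as base the
  step `Layer 0 → Layer 1` would BE `RankOneSchanuel`, and the stub alone would then give the crux by
  induction (costume); as stated it gives nothing without the base layer.  Conversely the crux implies it
  outright (`fun r _ _ => h (r+1)`), so the split loses nothing: crux ⟺ stub_rankOne ∧ stub_rankClimb.
  Remark for graders (not used): the COVER variant "∀ r ≥ 2, Layer r" was rejected as stub 2 because it is
  of full Schanuel strength by padding (from a rank-1 tuple `βζ` pass to the rank-2 tuple `(βζ, w)` with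
  `w ∈ {πi, log 2} ∖ ℚ̄ζ`, which exists by Gel'fond–Schneider, and `e^w ∈ ℚ̄` costs no transcendence degree);
  the climb form assumes `Layer r` and is not known to be of Schanuel strength unless `RankOneSchanuel` is
  proved.

`QbarRankGradedSchanuel_of : Sig.stub_rankOne → Sig.stub_rankClimb → QbarRankGradedSchanuel` is PROVED (§3:
`r = 0` vacuous, `r = 1` from stub 1 by the `Fin 1` bookkeeping, `r + 2` from the induction hypothesis by
stub 2).  `lean check`: sorries ONLY in the two `stub_*` theorems (2 sorries = 2 stubs, zero elsewhere).

BC3 probes (registrar, 2026-08-17, files `bc/probe_stub_rankOne.lean`, `bc/probe_stub_rankClimb.lean`,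
`bc/probe_split_tactics.lean` of the registrar's folder, importing only the route file; `lean check` rc 1 each):
for each stub signature `S ∈ {S₁, S₂}` (spelled out) and each target `T ∈ {QbarRankGradedSchanuel, Schanuel}`,
`set_option maxHeartbeats 400000 in example : S → T := by first | exact? | simpa | aesop` FAILS (deterministic
timeout inside `exact?`, 4/4), the unfolded variants `first | simpa [S, T] | (unfold S T; simpa) | (unfold S T;
intro h; exact?) | (unfold S T; aesop)` FAIL (4/4), and one tactic at a time (12/12 fail): `exact?` — timeout at
400000 heartbeats, nothing found; `simpa` — "Tactic `assumption` failed ⊢ S → T"; `aesop` — "failed to prove the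
goal after exhaustive search", unsolved `a : S ⊢ T`.  `lean search 'QbarRankGradedSchanuel|RankOneSchanuel'`:
the only declarations mentioning either are the route file's defs and its `closes` (14 hypotheses) — no landed
theorem of shape `S → T`, `T ↔ S` or `¬S → ¬T`.  No stub is cheaply the crux or the summit.

Disproof used: none exists for this crux (`ledger crux ls stmt-Schanuel-3762`: no workfiles before this one;
no `disproof_path` in the payload; no `Theorems/QbarRankGradedSchanuel/Negative/*`).  Negatives index
(`ledger negatives --problem Schanuel`, 2026-08-17: 2 refuted statements, both the `trdeg < n` phantoms of
route PolarPhantoms, items 6844/6846): nothing refuted is a layer of the graded conjecture or the rank-one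
statement; `RankOneSchanuel` is a grounded, refuter-checked OPEN item (3766).
Sources: Lang1966 (pp. 30–31), Waldschmidt2000 (Conj. 1.14), FischlerRivoal2025 (arXiv:2503.20345, p. 10:
the r = 1 sentence), the route file's header.
-/

noncomputable section

-- every `Summit.Schanuel.Schanuel.…` name repeats the summit = sub-problem segment (D-0017 layout); deliberate.
set_option linter.dupNamespace false
set_option linter.unusedVariables false

namespace Summit.Schanuel.Schanuel.Cruxes.QbarRankGradedSchanuel.Birth

open scoped BigOperators
open Summit.Schanuel.Schanuel.Theses.CoprimeExpPolynomials (QbarRankGradedSchanuel RankOneSchanuel)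

/-! ## §0 Read-back vocabulary — the `r`-th layer of the crux, verbatim -/

/-- `Layer r`: Schanuel's conjecture for tuples of exact ℚ̄-rank `r` — the body of the crux
`QbarRankGradedSchanuel` at a fixed `r`, copied token for token (so that the crux is `∀ r, Layer r` by
`Iff.rfl`, checked below): for `ζ : Fin r → ℂ` with no non-trivial algebraic-coefficient linear relation and
`b : Fin n → Fin r → ℂ` algebraic with `ℚ`-linearly independent rows,
`n ≤ trdeg_ℚ ℚ(range ζ ∪ range (i ↦ exp (∑ j, b i j * ζ j)))`. -/
def Layer (r : ℕ) : Prop :=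
  ∀ (n : ℕ) (ζ : Fin r → ℂ) (b : Fin n → Fin r → ℂ), (∀ c : Fin r → ℂ, (∀ j, IsAlgebraic ℚ (c j)) →
    ∑ j, c j * ζ j = 0 → c = 0) → (∀ i j, IsAlgebraic ℚ (b i j)) → LinearIndependent ℚ b →
    (n : Cardinal) ≤ Algebra.trdeg ℚ ↥(IntermediateField.adjoin ℚ (Set.range ζ ∪ Set.range (fun i =>
    Complex.exp (∑ j, b i j * ζ j))))

/-- Read-back: the crux IS the conjunction of its layers, definitionally. -/
example : QbarRankGradedSchanuel ↔ ∀ r, Layer r := Iff.rfl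

/-! ## §1 The stub SIGNATURES (`Sig.stub_<name>`; the skeleton audit reads the hypotheses of
`QbarRankGradedSchanuel_of` BY NAME, heads = stub names) -/

/-- **STUB 1 — THE BASE LAYER `r = 1` = `RankOneSchanuel`** (route support item stmt-Schanuel-3766, verbatim;
"Lindemann–Weierstrass at a transcendental scale"): for `ζ ≠ 0` and algebraic, `ℚ`-linearly independent
`β₁, …, βₙ`, `n ≤ trdeg_ℚ ℚ(ζ, e^{β₁ζ}, …, e^{βₙζ})`.  Open (a special case of Schanuel containing Gel'fond's
conjecture `(log 2, 2^√2)` and `(π, e^{π√2 i})`); fed inside the route by crux 2 through `RankOneOfCoprime`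
(3768).  Why it might fail: only if Schanuel fails on a line `ℚ̄ζ`; unconditionally known for `ζ` algebraic
(Lindemann–Weierstrass, tree) and for `n = 1` (Hermite–Lindemann).  Sources: FischlerRivoal2025
(arXiv:2503.20345) Thm 1.7/4.1 and p. 10; Lang1966; Baker1975.  Size: XL / open. -/
def Sig.stub_rankOne : Prop :=
  ∀ (n : ℕ) (ζ : ℂ) (β : Fin n → ℂ), ζ ≠ 0 → (∀ i, IsAlgebraic ℚ (β i)) → LinearIndependent ℚ β →
    (n : Cardinal) ≤ Algebra.trdeg ℚ ↥(IntermediateField.adjoin ℚ (insert ζ (Set.range fun i =>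
    Complex.exp (β i * ζ))))

/-- Read-back: stub 1 IS the route item `RankOneSchanuel`, definitionally. -/
example : Sig.stub_rankOne ↔ RankOneSchanuel := Iff.rfl

/-- **STUB 2 — CLIMBING THE ℚ̄-RANK BY ONE** (the inductive step; HARDEST, no mechanism in this route):
for every `r ≥ 1`, Schanuel for tuples of exact ℚ̄-rank `r` implies Schanuel for tuples of exact ℚ̄-rank
`r + 1` (`Layer r → Layer (r + 1)`, both layers spelled out).  Why it might fail / be out of reach: `Layer 2`
contains `(1, πi)` and the algebraic independence of two `ℚ̄`-independent logarithms of algebraic numbers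
(`Literature.Barriers.Schanuel.AlgebraicIndependenceOfLogarithms`), and nothing one-variable (Ritt
factorisation, Shapiro counting, p-adic SML) survives the passage from a line to a plane; stated from `r ≥ 1`
so that it is NOT the crux in costume (from `r ≥ 0` the vacuous `Layer 0` would make it the whole crux by
induction).  Sources: Lang1966 pp. 30–31; Waldschmidt2000 Conj. 1.14; the crux's recorded why-might-fail and
the route review refuter-rreview aa031e05 (2026-08-15).  Size: XL / open. -/
def Sig.stub_rankClimb : Prop :=
  ∀ r : ℕ, 1 ≤ r → Layer r → Layer (r + 1)

/-! ## §2 The registered stubs (the ONLY `sorry`s of this file; signatures spelled out over Mathlib only) -/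

/-- Registered stub 1 (XL, open): the base layer — `RankOneSchanuel` verbatim.  See `Sig.stub_rankOne`. -/
theorem stub_rankOne :
    ∀ (n : ℕ) (ζ : ℂ) (β : Fin n → ℂ), ζ ≠ 0 → (∀ i, IsAlgebraic ℚ (β i)) → LinearIndependent ℚ β →
      (n : Cardinal) ≤ Algebra.trdeg ℚ ↥(IntermediateField.adjoin ℚ (insert ζ (Set.range fun i =>
      Complex.exp (β i * ζ)))) := by
  sorry

/-- Registered stub 2 (XL, open, hardest): climbing the ℚ̄-rank by one, `∀ r ≥ 1, Layer r → Layer (r + 1)`,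
both layers spelled out.  See `Sig.stub_rankClimb`. -/
theorem stub_rankClimb :
    ∀ r : ℕ, 1 ≤ r →
      (∀ (n : ℕ) (ζ : Fin r → ℂ) (b : Fin n → Fin r → ℂ), (∀ c : Fin r → ℂ, (∀ j, IsAlgebraic ℚ (c j)) →
        ∑ j, c j * ζ j = 0 → c = 0) → (∀ i j, IsAlgebraic ℚ (b i j)) → LinearIndependent ℚ b →
        (n : Cardinal) ≤ Algebra.trdeg ℚ ↥(IntermediateField.adjoin ℚ (Set.range ζ ∪ Set.range (fun i =>
        Complex.exp (∑ j, b i j * ζ j))))) →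
      (∀ (n : ℕ) (ζ : Fin (r + 1) → ℂ) (b : Fin n → Fin (r + 1) → ℂ), (∀ c : Fin (r + 1) → ℂ,
        (∀ j, IsAlgebraic ℚ (c j)) → ∑ j, c j * ζ j = 0 → c = 0) → (∀ i j, IsAlgebraic ℚ (b i j)) →
        LinearIndependent ℚ b →
        (n : Cardinal) ≤ Algebra.trdeg ℚ ↥(IntermediateField.adjoin ℚ (Set.range ζ ∪ Set.range (fun i =>
        Complex.exp (∑ j, b i j * ζ j))))) := by
  sorry

/-- Read-back: the registered stubs ARE the named signatures, definitionally. -/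
example : Sig.stub_rankOne := stub_rankOne
example : Sig.stub_rankClimb := stub_rankClimb

/-! ## §3 The composition — the crux BY NAME from the two stubs (real proof, no `sorry`) -/

/-- The vacuous layer `r = 0`: the rows of `b` lie in the zero module `Fin 0 → ℂ`, so a `ℚ`-linearly
independent `b : Fin n → Fin 0 → ℂ` forces `n = 0`, and `0 ≤ trdeg` always. -/
theorem layer_zero : Layer 0 := by
  intro n ζ b hζ hb hli
  rcases Nat.eq_zero_or_pos n with rfl | hn
  · simp
  · exact absurd (Subsingleton.elim _ _) (hli.ne_zero ⟨0, hn⟩)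

/-- For `ζ : Fin 1 → ℂ`, `range ζ ∪ range (i ↦ exp (∑ j, b i j * ζ j)) = insert (ζ 0) (range (i ↦ exp (b i 0 * ζ 0)))`. -/
theorem sets_fin_one {n : ℕ} (ζ : Fin 1 → ℂ) (b : Fin n → Fin 1 → ℂ) :
    Set.range ζ ∪ Set.range (fun i => Complex.exp (∑ j, b i j * ζ j)) =
      insert (ζ 0) (Set.range fun i => Complex.exp (b i 0 * ζ 0)) := by
  have h1 : Set.range ζ = {ζ 0} := by
    ext x
    simp only [Set.mem_range, Set.mem_singleton_iff]
    constructor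
    · rintro ⟨j, rfl⟩
      rw [Subsingleton.elim j 0]
    · rintro rfl
      exact ⟨0, rfl⟩
  have h2 : (fun i => Complex.exp (∑ j, b i j * ζ j)) = fun i => Complex.exp (b i 0 * ζ 0) := by
    funext i
    rw [Fin.sum_univ_one]
  rw [h1, h2, Set.singleton_union]

/-- The base layer from stub 1: `RankOneSchanuel → Layer 1` (one coordinate `ζ 0 ≠ 0`, slopes `b i 0`
algebraic and `ℚ`-independent, and the two adjoined sets agree by `sets_fin_one`). -/
theorem layer_one_of_rankOne (h₁ : Sig.stub_rankOne) : Layer 1 := by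
  intro n ζ b hζ hb hli
  -- the single coordinate is non-zero: otherwise `c = 1` is a non-trivial algebraic relation
  have hζ0 : ζ 0 ≠ 0 := by
    intro h0
    have hc := hζ (fun _ => 1) (fun _ => isAlgebraic_one) (by simp [h0])
    have h10 : (1 : ℂ) = 0 := by simpa using congr_fun hc 0
    exact one_ne_zero h10
  -- the slopes are ℚ-linearly independent: evaluate at the unique coordinate
  have hβ : LinearIndependent ℚ (fun i => b i 0) := by
    have hker : LinearMap.ker (LinearMap.proj (R := ℚ) (φ := fun _ : Fin 1 => ℂ) 0) = ⊥ := by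
      rw [LinearMap.ker_eq_bot]
      intro f g hfg
      funext j
      rw [Subsingleton.elim j 0]
      exact hfg
    exact hli.map' _ hker
  have key := h₁ n (ζ 0) (fun i => b i 0) hζ0 (fun i => hb i 0) hβ
  -- transport along the equality of adjoined sets (generalised, to keep the motive type-correct)
  have main : ∀ S : Set ℂ, S = insert (ζ 0) (Set.range fun i => Complex.exp (b i 0 * ζ 0)) →
      (n : Cardinal) ≤ Algebra.trdeg ℚ ↥(IntermediateField.adjoin ℚ S) := by
    rintro S rfl
    exact key
  exact main _ (sets_fin_one ζ b)

/-- **Skeleton theorem.**  The base layer (`RankOneSchanuel`) and the rank-climbing step imply the crux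
`Theses.CoprimeExpPolynomials.QbarRankGradedSchanuel` BY NAME: induction on the ℚ̄-rank `r`, with `r = 0`
vacuous (`layer_zero`), `r = 1` the base (`layer_one_of_rankOne`) and `r + 2` from `r + 1` by stub 2. -/
theorem QbarRankGradedSchanuel_of :
    Sig.stub_rankOne → Sig.stub_rankClimb → QbarRankGradedSchanuel := by
  intro h₁ h₂
  have pos : ∀ k : ℕ, Layer (k + 1) := by
    intro k
    induction k with
    | zero => exact layer_one_of_rankOne h₁
    | succ k ih => exact h₂ (k + 1) (Nat.succ_pos k) ih
  intro r
  cases r with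
  | zero => exact layer_zero
  | succ k => exact pos k

/-- The crux by name, closed modulo the two registered stubs (an `example`, so that `QbarRankGradedSchanuel_of`
stays the unique theorem of this file concluding the crux; its own axiom closure is sorry-free). -/
example : QbarRankGradedSchanuel :=
  QbarRankGradedSchanuel_of stub_rankOne stub_rankClimb

/-- Converse bookkeeping (not a stub, recorded for graders): the crux gives the climbing step outright, so the
split `stub_rankOne ∧ stub_rankClimb` loses nothing (the other converse, crux → `RankOneSchanuel`, is the
route's support item `RankOneOfGraded`, stmt-Schanuel-3769). -/
theorem rankClimb_of_graded (h : QbarRankGradedSchanuel) : Sig.stub_rankClimb :=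
  fun r _ _ => h (r + 1)

end Summit.Schanuel.Schanuel.Cruxes.QbarRankGradedSchanuel.Birth

end
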